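import Literature.AnabelianGeometry.SemiGraphs.PSCUnrVerticialSeparatingCoveringsTwoComponentAffine
import HarnessLib

/-!
# [CombGC] Prop. 1.2, proof p. 9: rows F-2829 / F-2830 at ALL genuine two-component affine data (sturdy case included)

Mochizuki, *A combinatorial version of the Grothendieck conjecture*, Tohoku Math. J. **59** (2007)
[CombGC], PROOF of Proposition 1.2, author's manuscript p. 9 (separating coverings)
[cite: MochizukiCombGC2007, Prop 1.2 proof p.9]; abc-iut FACT-LIST rows F-2829
`PSCDatum.SeparatingCoverings` (= verticial ∧ edge-like ∧ `Π^unr`-verticial separating coverings, sub-DAG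
row P12-L01 of abc-iut-w4-d081's `PSCSeparatingCoverings.lean`) and F-2830 `SeparatingCoveringsHolds Ω`.

PROOF-ONLY file (abc-iut-w5-d047 gen 7), the assembly closing door D1 of abc-iut-f-166's programme: at the
two-component affine data of abc-iut-f-164 the verticial conjunct (`PSCSeparatingCoveringsTwoComponentAffine`,
p457653) and the edge-like conjunct (`…Edges`, p458933) hold by the free-factor theorems, and the `Π^unr`
conjunct holds at EVERY such datum by `unrVerticialSeparatingCoverings_of_twoComponentAffine` (this
lineage, p469543: genuine at sturdy data — fibred twist / projection in `Γ/⟨⟨c_j, ε⟩⟩ ≅ Γ_{g₀,0} ∗ Γ_{g−g₀,0}`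
transferred along the pro-`Σ` completion — and vacuous otherwise).  Hence:

* `separatingCoverings_of_twoComponentAffine` — **row F-2829 at every two-component affine datum** with
  `s ≥ 2` cusps on `C₁` and `r − s ≥ 2` on `C₀` (no genus restriction; supersedes the non-sturdy
  `separatingCoverings_of_twoComponentAffine_of_not_isSturdy`);
* `exists_twoComponentAffine_separatingCoverings_sturdy` — non-vacuity AT STURDY DATA: an inhabited datum
  with two genus-`2` components, one node and four cusps satisfying F-2829 **and** `IsSturdy` (so the
  `Π^unr` conjunct is exercised, not vacuous);
* `exists_twoComponentAffineOrigin_separatingCoveringsHolds_all` — **row F-2830 at the (inhabited) origin of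
  ALL two-component affine data**, the genus pins replacing the former `¬ IsSturdy` clause.

A shape instance is consistency evidence for the typed schema, not the printed statement for all pointed
stable curves (cell FOUNDATIONS rows 13–14).  0 definitions; nothing here takes a side on [IUTchIII] Cor. 3.12.
-/

noncomputable section

namespace Literature.AnabelianGeometry.SemiGraphs

namespace PSCDatum

open scoped Pointwise
open Literature.GroupTheory.CombinatorialGroupTheory
open Literature.GroupTheory.CombinatorialGroupTheory.PuncturedSurfaceGroup (cuspInertia)
open SemiGraphOfAnabelioids (IsProSigmaCompletion)

section TwoComponentAffine

variable {P : Type} [Group P] [TopologicalSpace P] [IsTopologicalGroup P]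
variable [CompactSpace P] [TotallyDisconnectedSpace P] {Sigma : Set ℕ} {g r : ℕ}

/-- **Row F-2829 `SeparatingCoverings` at EVERY genuine two-component affine datum** (`s ≥ 2` cusps on `C₁`,
`r − s ≥ 2` on `C₀`, genera `g₀`, `g − g₀` arbitrary): verticial conjunct by the fibred twist / projection
for free factors, edge-like conjunct by rank-one free factors, `Π^unr` conjunct by
`unrVerticialSeparatingCoverings_of_twoComponentAffine`. [cite: MochizukiCombGC2007, Prop 1.2 proof p.9] -/
theorem separatingCoverings_of_twoComponentAffine (hne : Sigma.Nonempty)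
    (hprime : ∀ p ∈ Sigma, p.Prime) (ι : PuncturedSurfaceGroup g r →* P)
    (hι : IsProSigmaCompletion Sigma ι) (G : PSCDatum P) {g₀ s : ℕ} (hs : 2 ≤ s) (hsr : s + 2 ≤ r)
    (e : G.graph.C ≃ Fin r)
    (hC : ∀ c, G.cuspGp c = ((cuspInertia (g := g) (e c)).map ι).topologicalClosure)
    (v₀ v₁ : G.graph.V) (hV : ∀ w, w = v₀ ∨ w = v₁) (n₀ : G.graph.N) (hN : ∀ n, n = n₀)
    (ε : PuncturedSurfaceGroup g r)
    (hε : ε = ((List.finRange r).map fun j : Fin r =>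
          if s ≤ (j : ℕ) then PuncturedSurfaceGroup.c (g := g) j else 1).prod *
        ((List.finRange g).map fun i : Fin g => if (i : ℕ) < g₀ then
          PuncturedSurfaceGroup.a (r := r) i * PuncturedSurfaceGroup.b i *
            (PuncturedSurfaceGroup.a i)⁻¹ * (PuncturedSurfaceGroup.b i)⁻¹ else 1).prod)
    (hV₀ : G.vertGp v₀ = ((Subgroup.closure {x : PuncturedSurfaceGroup g r |
        (∃ i : Fin g, (i : ℕ) < g₀ ∧ (x = PuncturedSurfaceGroup.a i ∨ x = PuncturedSurfaceGroup.b i)) ∨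
        ∃ j : Fin r, s ≤ (j : ℕ) ∧ x = PuncturedSurfaceGroup.c j}).map ι).topologicalClosure)
    (hV₁ : G.vertGp v₁ = ((Subgroup.closure {x : PuncturedSurfaceGroup g r |
        (∃ i : Fin g, g₀ ≤ (i : ℕ) ∧ (x = PuncturedSurfaceGroup.a i ∨ x = PuncturedSurfaceGroup.b i)) ∨
        (∃ j : Fin r, (j : ℕ) < s ∧ x = PuncturedSurfaceGroup.c j) ∨ x = ε}).map ι).topologicalClosure)
    (hE : G.nodeGp n₀ = ((Subgroup.zpowers ε).map ι).topologicalClosure)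
    (hgen₀ : G.genus v₀ = g₀) (hgen₁ : G.genus v₁ = g - g₀) :
    G.SeparatingCoverings :=
  ⟨G.verticialSeparatingCoverings_of_twoComponentAffine hne hprime ι hι hs hsr v₀ v₁ hV ε hε hV₀ hV₁,
    G.edgeLikeSeparatingCoverings_of_twoComponentAffine hne hprime ι hι hs hsr e hC n₀ hN ε hε hE,
    G.unrVerticialSeparatingCoverings_of_twoComponentAffine hne hprime ι hι e hC n₀ hN v₀ v₁ hV ε hε hV₀
      hV₁ hE hgen₀ hgen₁⟩

/-- **Non-vacuity of row F-2829 at STURDY multi-vertex data**: for every nonempty set of primes `Σ` an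
inhabited profinite pro-`Σ` datum with TWO genus-`2` vertices, ONE node and four cusps (abc-iut-f-164's
`exists_twoComponentAffineDatum 4 4 2 2`) is sturdy AND satisfies `SeparatingCoverings` — so the `Π^unr`
conjunct is exercised at a genuine datum. [cite: MochizukiCombGC2007, Prop 1.2 proof p.9] -/
theorem exists_twoComponentAffine_separatingCoverings_sturdy (Sigma : Set ℕ) (hne : Sigma.Nonempty)
    (hprime : ∀ p ∈ Sigma, p.Prime) :
    ∃ (Q : ProfiniteGrp.{0}) (G : PSCDatum Q), G.Sigma = Sigma ∧ G.graph.i = 2 ∧ G.graph.n = 1 ∧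
      G.graph.r = 4 ∧ (∀ v, G.genus v = 2) ∧ G.IsSturdy ∧ G.SeparatingCoverings := by
  obtain ⟨Q, ι, G, e, v₀, v₁, n₀, ε, hι, hSg, hi, hn, hr, hC, hV, hN, hε, hV₀, hV₁, hE, hg₀, hg₁, -⟩ :=
    exists_twoComponentAffineDatum Sigma hne hprime 4 4 2 2
  have hgen : ∀ v, G.genus v = 2 := fun v => by
    rcases hV v with rfl | rfl
    · exact hg₀
    · exact hg₁
  exact ⟨Q, G, hSg, hi, hn, hr, hgen, fun v => by rw [hgen v],
    G.separatingCoverings_of_twoComponentAffine hne hprime ι hι (g₀ := 2) (s := 2) le_rfl le_rfl e hC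
      v₀ v₁ hV n₀ hN ε hε hV₀ hV₁ hE hg₀ hg₁⟩

end TwoComponentAffine

/-! ### Row F-2830 at the origin of all two-component affine data -/

/-- **Row F-2830 `SeparatingCoveringsHolds Ω` at the INHABITED origin `Ω_tca` of ALL data of two-component
affine shape** (over profinite pro-`Σ` completions of `Γ_{g,r}` in `Type`; abc-iut-f-164's shape with the
genus pins `genus v₀ = g₀`, `genus v₁ = g − g₀`, no sturdiness restriction): every datum of the origin has
separating coverings (all three conjuncts genuine where non-vacuous), and the origin is inhabited by a STURDY
datum (two genus-`2` vertices, one node, four cusps). [cite: MochizukiCombGC2007, Prop 1.2 proof p.9] -/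
theorem exists_twoComponentAffineOrigin_separatingCoveringsHolds_all (Sigma : Set ℕ) (hne : Sigma.Nonempty)
    (hprime : ∀ p ∈ Sigma, p.Prime) :
    ∃ Ω : PSCOrigin.{0},
      (∃ (Q : ProfiniteGrp.{0}) (G : PSCDatum Q), Ω.IsOfPSCType G ∧ G.IsSturdy ∧ G.Sigma = Sigma ∧
        G.graph.i = 2 ∧ G.graph.n = 1 ∧ G.graph.r = 4) ∧
      SeparatingCoveringsHolds Ω := by
  classical
  let Ω : PSCOrigin.{0} :=
    ⟨fun {Q} _ _ G => ∃ (_ : IsTopologicalGroup Q), CompactSpace Q ∧ TotallyDisconnectedSpace Q ∧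
      ∃ (S : Set ℕ) (g r g₀ s : ℕ) (ι : PuncturedSurfaceGroup g r →* Q) (e : G.graph.C ≃ Fin r)
        (v₀ v₁ : G.graph.V) (n₀ : G.graph.N) (ε : PuncturedSurfaceGroup g r),
        S.Nonempty ∧ (∀ p ∈ S, p.Prime) ∧ IsProSigmaCompletion S ι ∧ 2 ≤ s ∧ s + 2 ≤ r ∧
        (∀ c, G.cuspGp c = ((cuspInertia (g := g) (e c)).map ι).topologicalClosure) ∧
        (∀ w, w = v₀ ∨ w = v₁) ∧ (∀ n, n = n₀) ∧
        ε = ((List.finRange r).map fun j : Fin r =>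
          if s ≤ (j : ℕ) then PuncturedSurfaceGroup.c (g := g) j else 1).prod *
        ((List.finRange g).map fun i : Fin g => if (i : ℕ) < g₀ then
          PuncturedSurfaceGroup.a (r := r) i * PuncturedSurfaceGroup.b i *
            (PuncturedSurfaceGroup.a i)⁻¹ * (PuncturedSurfaceGroup.b i)⁻¹ else 1).prod ∧
        G.vertGp v₀ = ((Subgroup.closure {x : PuncturedSurfaceGroup g r |
          (∃ i : Fin g, (i : ℕ) < g₀ ∧ (x = PuncturedSurfaceGroup.a i ∨ x = PuncturedSurfaceGroup.b i)) ∨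
          ∃ j : Fin r, s ≤ (j : ℕ) ∧ x = PuncturedSurfaceGroup.c j}).map ι).topologicalClosure ∧
        G.vertGp v₁ = ((Subgroup.closure {x : PuncturedSurfaceGroup g r |
          (∃ i : Fin g, g₀ ≤ (i : ℕ) ∧ (x = PuncturedSurfaceGroup.a i ∨ x = PuncturedSurfaceGroup.b i)) ∨
          (∃ j : Fin r, (j : ℕ) < s ∧ x = PuncturedSurfaceGroup.c j) ∨ x = ε}).map ι).topologicalClosure ∧
        G.nodeGp n₀ = ((Subgroup.zpowers ε).map ι).topologicalClosure ∧
        G.genus v₀ = g₀ ∧ G.genus v₁ = g - g₀⟩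
  refine ⟨Ω, ?_, ?_⟩
  · obtain ⟨Q, ι, G, e, v₀, v₁, n₀, ε, hι, hSg, hi, hn, hr, hC, hV, hN, hε, hV₀, hV₁, hE, hg₀, hg₁, -⟩ :=
      exists_twoComponentAffineDatum Sigma hne hprime 4 4 2 2
    have hgen : ∀ v, G.genus v = 2 := fun v => by
      rcases hV v with rfl | rfl
      · exact hg₀
      · exact hg₁
    refine ⟨Q, G, ?_, fun v => by rw [hgen v], hSg, hi, hn, hr⟩
    exact ⟨inferInstance, inferInstance, inferInstance,
      Sigma, 4, 4, 2, 2, ι, e, v₀, v₁, n₀, ε, hne, hprime, hι, le_rfl, le_rfl, hC, hV, hN, hε, hV₀, hV₁, hE,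
      hg₀, hg₁⟩
  · intro Q _ _ _ G hG
    obtain ⟨_, hcpt, htd, S, g, r, g₀, s, ι, e, v₀, v₁, n₀, ε, hSne, hSp, hι, hs, hsr, hC, hV, hN, hε,
      hV₀, hV₁, hE, hg₀, hg₁⟩ := hG
    haveI := hcpt
    haveI := htd
    exact G.separatingCoverings_of_twoComponentAffine hSne hSp ι hι hs hsr e hC v₀ v₁ hV n₀ hN ε hε hV₀
      hV₁ hE hg₀ hg₁

end PSCDatum

end Literature.AnabelianGeometry.SemiGraphs

end
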